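import Mathlib

/-!
# Crux `DrudeDissolution` (stmt-AtomisticToContinuum-12593): necessary conditions carried by a
# current spectral representation `C(t) = ∫ cos(ωt) dσ(ω)` — no Drude atom, Wiener–Cesàro, Mazur handle

Negative-lane support lemmas of the standing crux disprover (cycle 1), extracted from the crux
workfile `Summits/AtomisticToContinuum/FouriersLaw/Cruxes/DrudeDissolution/Disproof.lean` §2.
The crux asserts, for the pinned doubly-quartic chain at small `T`, a finite measure `σ` with
`C_T(t) = ∫ cos(ωt) dσ(ω)` (the summed current autocorrelation) and a window `(−δ, δ)` on which
`σ = g dω`, `g` continuous `≥ 0`, `g 0 > 0`. This file records, in pure measure theory (Mathlib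
only, no chain objects), what such a representation FORCES on `C` — the refuter's kill handles and
the prover's obligations on `InfiniteChainDynamics.currentCorrelation`:

* `cosine_zero`, `cosine_even`, `abs_cosine_le`, `continuous_cosine`, `cosine_posSemidef`:
  `C 0 = σ(ℝ)`, `C` even, `|C| ≤ C 0`, continuous, positive semi-definite;
* `atom_eq_zero_of_window`: a window density excludes a DRUDE ATOM, `σ {0} = 0`;
* `tendsto_cesaro_atom` (Wiener's lemma for the cosine transform): `R⁻¹ ∫₀^R C → σ{0}`;
  hence `tendsto_cesaro_zero_of_window`;
* `le_atom_of_frequently_cesaro`, `not_window_of_frequently_cesaro` (MAZUR HANDLE: Cesàro means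
  frequently `≥ d > 0` ⇒ atom `≥ d` ⇒ no window density), `le_atom_of_floor`,
  `not_window_of_floor`, `not_window_of_conserved`, `measure_window_pos`, `not_window_of_conserved₀`
  (a Drude floor / a conserved correlation — the harmonic endpoint `lam = β = 0` — admits no window;
  a window carries positive spectral mass, so `C 0 = σ(ℝ) > 0`);
(Companion file `WindowNotL1.lean`: a window density does NOT imply `C ∈ L¹(0, ∞)`.)

Sorry-free; axioms `propext`, `Classical.choice`, `Quot.sound`.
-/

noncomputable section

namespace Summit.AtomisticToContinuum.FouriersLaw.Theorems.DrudeDissolution.Negative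

open MeasureTheory Filter Set Topology
open scoped ENNReal

section CosineTransform

variable {C : ℝ → ℝ} {σ : Measure ℝ}

/-- `C(0) = σ(ℝ)`: the total spectral mass is the static current susceptibility. -/
theorem cosine_zero [IsFiniteMeasure σ] (hC : ∀ t : ℝ, C t = ∫ ω, Real.cos (ω * t) ∂σ) :
    C 0 = σ.real univ := by
  rw [hC 0]
  simp [integral_const]

/-- `C` is even. -/
theorem cosine_even (hC : ∀ t : ℝ, C t = ∫ ω, Real.cos (ω * t) ∂σ) (t : ℝ) : C (-t) = C t := by
  rw [hC, hC]
  simp [mul_neg, Real.cos_neg]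

/-- `|C(t)| ≤ C(0)`. -/
theorem abs_cosine_le [IsFiniteMeasure σ] (hC : ∀ t : ℝ, C t = ∫ ω, Real.cos (ω * t) ∂σ) (t : ℝ) :
    |C t| ≤ C 0 := by
  rw [cosine_zero hC, hC t]
  have h := norm_integral_le_of_norm_le_const (μ := σ) (f := fun ω => Real.cos (ω * t)) (C := 1)
    (Eventually.of_forall fun ω => by
      rw [Real.norm_eq_abs]; exact Real.abs_cos_le_one _)
  rw [one_mul] at h
  simpa [Real.norm_eq_abs] using h

/-- `C` is continuous (dominated convergence). -/
theorem continuous_cosine [IsFiniteMeasure σ] (hC : ∀ t : ℝ, C t = ∫ ω, Real.cos (ω * t) ∂σ) :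
    Continuous C := by
  have : C = fun t => ∫ ω, Real.cos (ω * t) ∂σ := funext hC
  rw [this]
  refine continuous_of_dominated (bound := fun _ => (1 : ℝ)) ?_ ?_ (integrable_const 1) ?_
  · intro t
    exact (Real.continuous_cos.comp (continuous_id.mul continuous_const)).aestronglyMeasurable
  · intro t
    exact Eventually.of_forall fun ω => by
      rw [Real.norm_eq_abs]; exact Real.abs_cos_le_one _
  · exact Eventually.of_forall fun ω => Real.continuous_cos.comp (continuous_const.mul continuous_id)

/-- `C` is POSITIVE SEMI-DEFINITE (the easy half of Bochner): for all finite families,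
`Σᵢⱼ cᵢ cⱼ C(tᵢ − tⱼ) = ∫ [(Σ cᵢ cos ωtᵢ)² + (Σ cᵢ sin ωtᵢ)²] dσ ≥ 0`. -/
theorem cosine_posSemidef [IsFiniteMeasure σ] (hC : ∀ t : ℝ, C t = ∫ ω, Real.cos (ω * t) ∂σ)
    {n : ℕ} (c τ : Fin n → ℝ) :
    0 ≤ ∑ i, ∑ j, c i * c j * C (τ i - τ j) := by
  have hint : ∀ i j : Fin n,
      Integrable (fun ω => c i * c j * Real.cos (ω * (τ i - τ j))) σ := fun i j =>
    ((integrable_const (1 : ℝ)).mono'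
      ((Real.continuous_cos.comp (continuous_id.mul continuous_const)).aestronglyMeasurable)
      (Eventually.of_forall fun ω => by
        rw [Real.norm_eq_abs]; exact Real.abs_cos_le_one _)).const_mul (c i * c j)
  have key : ∀ ω : ℝ, ∑ i, ∑ j, c i * c j * Real.cos (ω * (τ i - τ j)) =
      (∑ i, c i * Real.cos (ω * τ i)) ^ 2 + (∑ i, c i * Real.sin (ω * τ i)) ^ 2 := by
    intro ω
    have hcos : ∀ i j : Fin n, Real.cos (ω * (τ i - τ j)) =
        Real.cos (ω * τ i) * Real.cos (ω * τ j) + Real.sin (ω * τ i) * Real.sin (ω * τ j) := by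
      intro i j; rw [mul_sub, Real.cos_sub]
    simp_rw [hcos, sq, Finset.sum_mul_sum, ← Finset.sum_add_distrib]
    refine Finset.sum_congr rfl fun i _ => Finset.sum_congr rfl fun j _ => ?_
    ring
  have hrepr : ∑ i, ∑ j, c i * c j * C (τ i - τ j) =
      ∫ ω, ∑ i, ∑ j, c i * c j * Real.cos (ω * (τ i - τ j)) ∂σ := by
    rw [integral_finsetSum _ (fun i _ => integrable_finsetSum _ fun j _ => hint i j)]
    refine Finset.sum_congr rfl fun i _ => ?_
    rw [integral_finsetSum _ (fun j _ => hint i j)]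
    refine Finset.sum_congr rfl fun j _ => ?_
    rw [hC, integral_const_mul]
  rw [hrepr]
  refine integral_nonneg fun ω => ?_
  show (0 : ℝ) ≤ _
  rw [key ω]
  positivity

/-! ### No Drude atom, and the Cesàro (Mazur) handle -/

/-- A WINDOW DENSITY EXCLUDES A DRUDE ATOM: if `σ = g dω` on `(−δ, δ)` then `σ {0} = 0`. So the
crux's conclusion is incompatible with any ballistic component of the current (kill criterion (a)
of the route is literally the negation of a clause of the conclusion). -/
theorem atom_eq_zero_of_window {δ : ℝ} {g : ℝ → ℝ} (hδ : 0 < δ)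
    (hw : σ.restrict (Ioo (-δ) δ) =
      (volume.restrict (Ioo (-δ) δ)).withDensity fun ω => ENNReal.ofReal (g ω)) :
    σ {0} = 0 := by
  have h0 : (0 : ℝ) ∈ Ioo (-δ) δ := ⟨by linarith, hδ⟩
  have h1 : σ {0} = σ.restrict (Ioo (-δ) δ) {0} := by
    rw [Measure.restrict_apply (measurableSet_singleton 0), inter_eq_left.mpr (singleton_subset_iff.2 h0)]
  rw [h1, hw]
  refine withDensity_absolutelyContinuous _ _ ?_
  rw [Measure.restrict_apply (measurableSet_singleton 0)]
  exact measure_mono_null inter_subset_left (by simp)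

/-- The CESÀRO KERNEL: `∫₀^R cos(ω t) dt = R · sinc(ω R)`. -/
theorem integral_cos_mul_eq (ω R : ℝ) :
    ∫ t in (0 : ℝ)..R, Real.cos (ω * t) = R * Real.sinc (ω * R) := by
  by_cases hω : ω = 0
  · subst hω
    simp
  · by_cases hR : R = 0
    · subst hR
      simp
    rw [intervalIntegral.integral_comp_mul_left (fun x => Real.cos x) hω, integral_cos,
      Real.sinc_of_ne_zero (mul_ne_zero hω hR)]
    simp only [mul_zero, Real.sin_zero, sub_zero, smul_eq_mul]
    field_simp

/-- For `R > 0`, the Cesàro mean of `C` over `[0, R]` is `∫ sinc(ω R) dσ(ω)` (Fubini). -/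
theorem cesaro_eq_integral_sinc [IsFiniteMeasure σ]
    (hC : ∀ t : ℝ, C t = ∫ ω, Real.cos (ω * t) ∂σ) {R : ℝ} (hR : 0 < R) :
    R⁻¹ * ∫ t in (0 : ℝ)..R, C t = ∫ ω, Real.sinc (ω * R) ∂σ := by
  have hCeq : (fun t => C t) = fun t => ∫ ω, Real.cos (ω * t) ∂σ := funext hC
  rw [hCeq, intervalIntegral.integral_of_le hR.le]
  -- Fubini on the finite product `Ioc 0 R × σ`
  have hswap : ∫ t in Ioc (0 : ℝ) R, ∫ ω, Real.cos (ω * t) ∂σ =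
      ∫ ω, (∫ t in Ioc (0 : ℝ) R, Real.cos (ω * t)) ∂σ := by
    refine integral_integral_swap (μ := volume.restrict (Ioc (0 : ℝ) R)) (ν := σ)
      (f := fun t ω => Real.cos (ω * t)) ?_
    refine (integrable_const (1 : ℝ)).mono' ?_ (Eventually.of_forall fun p => ?_)
    · exact (Real.continuous_cos.comp (continuous_snd.mul continuous_fst)).aestronglyMeasurable
    · rw [Real.norm_eq_abs]
      exact Real.abs_cos_le_one _
  rw [hswap]
  have hinner : ∀ ω : ℝ, ∫ t in Ioc (0 : ℝ) R, Real.cos (ω * t) = R * Real.sinc (ω * R) := by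
    intro ω
    rw [← intervalIntegral.integral_of_le hR.le, integral_cos_mul_eq]
  simp_rw [hinner]
  rw [integral_const_mul, ← mul_assoc, inv_mul_cancel₀ hR.ne', one_mul]

/-- **WIENER / CESÀRO LEMMA.** If `C(t) = ∫ cos(ωt) dσ` with `σ` finite, the Cesàro means of `C`
converge to the DRUDE WEIGHT `σ{0}`: `R⁻¹ ∫₀^R C(t) dt → σ{0}` as `R → ∞`. -/
theorem tendsto_cesaro_atom [IsFiniteMeasure σ] (hC : ∀ t : ℝ, C t = ∫ ω, Real.cos (ω * t) ∂σ) :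
    Tendsto (fun R : ℝ => R⁻¹ * ∫ t in (0 : ℝ)..R, C t) atTop (𝓝 (σ.real {0})) := by
  have hlim : Tendsto (fun R : ℝ => ∫ ω, Real.sinc (ω * R) ∂σ) atTop
      (𝓝 (∫ ω, ({0} : Set ℝ).indicator 1 ω ∂σ)) := by
    refine tendsto_integral_filter_of_dominated_convergence (fun _ => (1 : ℝ)) ?_ ?_
      (integrable_const 1) ?_
    · exact Eventually.of_forall fun R =>
        (Real.continuous_sinc.comp (continuous_id.mul continuous_const)).aestronglyMeasurable
    · exact Eventually.of_forall fun R => Eventually.of_forall fun ω => by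
        rw [Real.norm_eq_abs]; exact Real.abs_sinc_le_one _
    · refine Eventually.of_forall fun ω => ?_
      by_cases hω : ω = 0
      · subst hω
        simp only [zero_mul, Real.sinc_zero, mem_singleton_iff, indicator_of_mem, Pi.one_apply]
        exact tendsto_const_nhds
      · rw [indicator_of_notMem (by simpa using hω)]
        refine squeeze_zero_norm' (a := fun R => |ω|⁻¹ * R⁻¹) ?_ ?_
        · filter_upwards [eventually_gt_atTop (0 : ℝ)] with R hR
          rw [Real.norm_eq_abs]
          have hx : ω * R ≠ 0 := mul_ne_zero hω hR.ne'
          calc |Real.sinc (ω * R)| ≤ |ω * R|⁻¹ := by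
                -- `|sin x / x| ≤ |x|⁻¹` (cf. `Literature.NumberTheory.LFunctions.abs_sinc_le_inv_abs`)
                rw [Real.sinc_of_ne_zero hx, abs_div, div_eq_mul_inv]
                exact mul_le_of_le_one_left (inv_nonneg.mpr (abs_nonneg _)) (Real.abs_sin_le_one _)
            _ = |ω|⁻¹ * R⁻¹ := by rw [abs_mul, abs_of_pos hR, mul_inv]
        · have : Tendsto (fun R : ℝ => |ω|⁻¹ * R⁻¹) atTop (𝓝 (|ω|⁻¹ * 0)) :=
            tendsto_inv_atTop_zero.const_mul _
          rwa [mul_zero] at this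
  rw [integral_indicator_one (measurableSet_singleton 0)] at hlim
  refine hlim.congr' ?_
  filter_upwards [eventually_gt_atTop (0 : ℝ)] with R hR
  exact (cesaro_eq_integral_sinc hC hR).symm

/-- Hence, under a window density, **the Cesàro means of `C` tend to `0`**. -/
theorem tendsto_cesaro_zero_of_window [IsFiniteMeasure σ]
    (hC : ∀ t : ℝ, C t = ∫ ω, Real.cos (ω * t) ∂σ) {δ : ℝ} {g : ℝ → ℝ} (hδ : 0 < δ)
    (hw : σ.restrict (Ioo (-δ) δ) =
      (volume.restrict (Ioo (-δ) δ)).withDensity fun ω => ENNReal.ofReal (g ω)) :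
    Tendsto (fun R : ℝ => R⁻¹ * ∫ t in (0 : ℝ)..R, C t) atTop (𝓝 0) := by
  have h := tendsto_cesaro_atom hC
  rwa [measureReal_def, atom_eq_zero_of_window hδ hw, ENNReal.toReal_zero] at h

/-- **MAZUR HANDLE (refutation shape (a)).** If the Cesàro means of `C` are FREQUENTLY `≥ d > 0`
(e.g. Mazur's bound `liminf R⁻¹∫₀^R C ≥ ⟨JQ⟩²/⟨QQ⟩ > 0` from a conserved charge `Q` overlapping
the current), then `σ{0} ≥ d`: there is a Drude atom and no window density exists. -/
theorem le_atom_of_frequently_cesaro [IsFiniteMeasure σ]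
    (hC : ∀ t : ℝ, C t = ∫ ω, Real.cos (ω * t) ∂σ) {d : ℝ}
    (hfreq : ∃ᶠ R in atTop, d ≤ R⁻¹ * ∫ t in (0 : ℝ)..R, C t) : d ≤ σ.real {0} := by
  by_contra hlt
  push Not at hlt
  have hev : ∀ᶠ R in atTop, R⁻¹ * ∫ t in (0 : ℝ)..R, C t < d :=
    (tendsto_cesaro_atom hC).eventually (Iio_mem_nhds hlt)
  obtain ⟨R, h1, h2⟩ := (hfreq.and_eventually hev).exists
  exact absurd h2 (not_lt.mpr h1)

/-- Frequently-positive Cesàro means ⇒ no window density (for any `δ > 0` and any candidate `g`). -/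
theorem not_window_of_frequently_cesaro [IsFiniteMeasure σ]
    (hC : ∀ t : ℝ, C t = ∫ ω, Real.cos (ω * t) ∂σ) {d : ℝ} (hd : 0 < d)
    (hfreq : ∃ᶠ R in atTop, d ≤ R⁻¹ * ∫ t in (0 : ℝ)..R, C t) {δ : ℝ} {g : ℝ → ℝ} (hδ : 0 < δ) :
    σ.restrict (Ioo (-δ) δ) ≠
      (volume.restrict (Ioo (-δ) δ)).withDensity fun ω => ENNReal.ofReal (g ω) := by
  intro hw
  have h := le_atom_of_frequently_cesaro hC hfreq
  rw [measureReal_def, atom_eq_zero_of_window hδ hw, ENNReal.toReal_zero] at h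
  exact absurd h (not_le.mpr hd)

/-- **DRUDE FLOOR ⇒ NO WITNESS.** A pointwise floor `d ≤ C(t)` for `t ≥ t₀` (`d > 0`) — the
signature of a conserved current component, e.g. the harmonic chain `lam = β = 0` where the total
energy current is conserved (§4) — forces a Drude atom `σ{0} ≥ d`. -/
theorem le_atom_of_floor [IsFiniteMeasure σ] (hC : ∀ t : ℝ, C t = ∫ ω, Real.cos (ω * t) ∂σ)
    {d t₀ : ℝ} (ht₀ : 0 ≤ t₀) (hfloor : ∀ t : ℝ, t₀ ≤ t → d ≤ C t) : d ≤ σ.real {0} := by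
  have hcont : Continuous C := continuous_cosine hC
  set M : ℝ := C 0 with hM
  have hbd : ∀ t, |C t| ≤ M := abs_cosine_le hC
  -- lower bound of the Cesàro mean: R⁻¹∫₀^R C ≥ d - (t₀ (M + |d|)) / R for R > t₀
  have hlow : ∀ R : ℝ, t₀ < R →
      d - t₀ * (M + |d|) * R⁻¹ ≤ R⁻¹ * ∫ t in (0 : ℝ)..R, C t := by
    intro R hR
    have hRpos : 0 < R := lt_of_le_of_lt ht₀ hR
    have hsplit : ∫ t in (0 : ℝ)..R, C t = (∫ t in (0 : ℝ)..t₀, C t) + ∫ t in t₀..R, C t :=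
      (intervalIntegral.integral_add_adjacent_intervals (hcont.intervalIntegrable 0 t₀)
        (hcont.intervalIntegrable t₀ R)).symm
    have h1 : -(t₀ * M) ≤ ∫ t in (0 : ℝ)..t₀, C t := by
      have := intervalIntegral.abs_integral_le_integral_abs (f := C) (a := 0) (b := t₀) (μ := volume) ht₀
      have h2 : ∫ t in (0 : ℝ)..t₀, |C t| ≤ ∫ _ in (0 : ℝ)..t₀, M :=
        intervalIntegral.integral_mono_on ht₀ (hcont.abs.intervalIntegrable 0 t₀)
          (continuous_const.intervalIntegrable 0 t₀) fun t _ => hbd t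
      rw [intervalIntegral.integral_const, smul_eq_mul, sub_zero] at h2
      have := (abs_le.mp (this.trans h2)).1
      linarith
    have h3 : (R - t₀) * d ≤ ∫ t in t₀..R, C t := by
      have h4 : ∫ _ in t₀..R, d ≤ ∫ t in t₀..R, C t :=
        intervalIntegral.integral_mono_on hR.le (continuous_const.intervalIntegrable t₀ R)
          (hcont.intervalIntegrable t₀ R) fun t ht => hfloor t ht.1
      rwa [intervalIntegral.integral_const, smul_eq_mul] at h4
    have h5 : R * d - t₀ * (M + |d|) ≤ ∫ t in (0 : ℝ)..R, C t := by
      rw [hsplit]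
      have : t₀ * d ≤ t₀ * |d| := mul_le_mul_of_nonneg_left (le_abs_self d) ht₀
      nlinarith
    have h6 : d - t₀ * (M + |d|) * R⁻¹ = R⁻¹ * (R * d - t₀ * (M + |d|)) := by
      field_simp
    rw [h6]
    exact mul_le_mul_of_nonneg_left h5 (inv_nonneg.mpr hRpos.le)
  -- the lower bound tends to d
  have hlim : Tendsto (fun R : ℝ => d - t₀ * (M + |d|) * R⁻¹) atTop (𝓝 d) := by
    have : Tendsto (fun R : ℝ => d - t₀ * (M + |d|) * R⁻¹) atTop (𝓝 (d - t₀ * (M + |d|) * 0)) :=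
      tendsto_const_nhds.sub (tendsto_inv_atTop_zero.const_mul _)
    rwa [mul_zero, sub_zero] at this
  have hev : ∀ᶠ R in atTop, d - t₀ * (M + |d|) * R⁻¹ ≤ R⁻¹ * ∫ t in (0 : ℝ)..R, C t := by
    filter_upwards [eventually_gt_atTop t₀] with R hR using hlow R hR
  exact le_of_tendsto_of_tendsto hlim (tendsto_cesaro_atom hC) hev

/-- Drude floor ⇒ no window density (for any `δ > 0` and any candidate `g`). -/
theorem not_window_of_floor [IsFiniteMeasure σ] (hC : ∀ t : ℝ, C t = ∫ ω, Real.cos (ω * t) ∂σ)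
    {d t₀ : ℝ} (hd : 0 < d) (ht₀ : 0 ≤ t₀) (hfloor : ∀ t : ℝ, t₀ ≤ t → d ≤ C t)
    {δ : ℝ} {g : ℝ → ℝ} (hδ : 0 < δ) :
    σ.restrict (Ioo (-δ) δ) ≠
      (volume.restrict (Ioo (-δ) δ)).withDensity fun ω => ENNReal.ofReal (g ω) := by
  intro hw
  have h := le_atom_of_floor hC ht₀ hfloor
  rw [measureReal_def, atom_eq_zero_of_window hδ hw, ENNReal.toReal_zero] at h
  exact absurd h (not_le.mpr hd)

/-- A WINDOW CARRIES POSITIVE SPECTRAL MASS: `g` continuous at `0` with `g 0 > 0` gives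
`σ((−δ, δ)) > 0` — so a witness has `C(0) = σ(ℝ) > 0` (the conclusion is never met by `C ≡ 0`). -/
theorem measure_window_pos {δ : ℝ} {g : ℝ → ℝ} (hδ : 0 < δ) (hg : ContinuousOn g (Ioo (-δ) δ))
    (hgpos : 0 < g 0)
    (hw : σ.restrict (Ioo (-δ) δ) =
      (volume.restrict (Ioo (-δ) δ)).withDensity fun ω => ENNReal.ofReal (g ω)) :
    0 < σ (Ioo (-δ) δ) := by
  have h0 : (0 : ℝ) ∈ Ioo (-δ) δ := ⟨by linarith, hδ⟩
  -- continuity at 0: g > g 0 / 2 on a small interval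
  have hca : ContinuousAt g 0 := hg.continuousAt (Ioo_mem_nhds h0.1 h0.2)
  have hev : ∀ᶠ ω in 𝓝 (0 : ℝ), g 0 / 2 < g ω :=
    hca.eventually (Ioi_mem_nhds (by linarith : g 0 / 2 < g 0))
  obtain ⟨ε, hε, hball⟩ := Metric.eventually_nhds_iff.1 hev
  set η : ℝ := min (ε / 2) (δ / 2) with hη
  have hηpos : 0 < η := by positivity
  have hηε : η < ε := lt_of_le_of_lt (min_le_left _ _) (by linarith)
  have hηδ : η < δ := lt_of_le_of_lt (min_le_right _ _) (by linarith)
  have hsub : Ioo (-η) η ⊆ Ioo (-δ) δ := Ioo_subset_Ioo (by linarith) hηδ.le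
  have hlow : ∀ ω ∈ Ioo (-η) η, ENNReal.ofReal (g 0 / 2) ≤ ENNReal.ofReal (g ω) := by
    intro ω hω
    refine ENNReal.ofReal_le_ofReal (le_of_lt (hball ?_))
    rw [Real.dist_eq, sub_zero, abs_lt]
    exact ⟨by linarith [hω.1], by linarith [hω.2]⟩
  have h1 : σ (Ioo (-η) η) = σ.restrict (Ioo (-δ) δ) (Ioo (-η) η) := by
    rw [Measure.restrict_apply measurableSet_Ioo, inter_eq_left.mpr hsub]
  have h2 : ENNReal.ofReal (g 0 / 2) * volume (Ioo (-η) η) ≤ σ (Ioo (-η) η) := by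
    rw [h1, hw, withDensity_apply _ measurableSet_Ioo, Measure.restrict_restrict measurableSet_Ioo,
      inter_eq_left.mpr hsub, ← setLIntegral_const]
    exact setLIntegral_mono' measurableSet_Ioo fun ω hω => hlow ω hω
  have h3 : 0 < ENNReal.ofReal (g 0 / 2) * volume (Ioo (-η) η) := by
    rw [Real.volume_Ioo]
    refine ENNReal.mul_pos (ENNReal.ofReal_pos.mpr (by linarith)).ne' (ENNReal.ofReal_pos.mpr (by linarith)).ne'
  exact lt_of_lt_of_le (lt_of_lt_of_le h3 h2) (measure_mono hsub)

/-- Hence a CONSERVED correlation `C(t) = C(0)` (no sign hypothesis) admits no window density: either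
`C 0 > 0` (Drude floor) or `C 0 = σ(ℝ) = 0`, contradicting the positive window mass. -/
theorem not_window_of_conserved₀ [IsFiniteMeasure σ] (hC : ∀ t : ℝ, C t = ∫ ω, Real.cos (ω * t) ∂σ)
    (hcons : ∀ t, C t = C 0) {δ : ℝ} {g : ℝ → ℝ} (hδ : 0 < δ) (hg : ContinuousOn g (Ioo (-δ) δ))
    (hgpos : 0 < g 0) :
    σ.restrict (Ioo (-δ) δ) ≠
      (volume.restrict (Ioo (-δ) δ)).withDensity fun ω => ENNReal.ofReal (g ω) := by
  intro hw
  rcases lt_or_ge 0 (C 0) with hpos | hle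
  · exact not_window_of_floor hC hpos le_rfl (fun t _ => (hcons t).ge) hδ hw
  · have h0 : σ.real univ = 0 := le_antisymm (by rwa [← cosine_zero hC]) measureReal_nonneg
    have huniv : σ univ = 0 := (measureReal_eq_zero_iff (measure_ne_top σ _)).1 h0
    have := measure_window_pos hδ hg hgpos hw
    exact absurd (measure_mono_null (subset_univ _) huniv) this.ne'

end CosineTransform

/-- The abstract end of the harmonic obstruction: a CONSERVED correlation `C(t) = C(0) > 0`
(Drude floor with `t₀ = 0`) admits no window density — so at `lam = β = 0` every `(μ, D)` whose
summed correlation is conserved (the physical ones) fails the conclusion. -/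
theorem not_window_of_conserved {σ : Measure ℝ} [IsFiniteMeasure σ] {C : ℝ → ℝ}
    (hC : ∀ t : ℝ, C t = ∫ ω, Real.cos (ω * t) ∂σ) (hcons : ∀ t, C t = C 0) (h0 : 0 < C 0)
    {δ : ℝ} {g : ℝ → ℝ} (hδ : 0 < δ) :
    σ.restrict (Ioo (-δ) δ) ≠
      (volume.restrict (Ioo (-δ) δ)).withDensity fun ω => ENNReal.ofReal (g ω) :=
  not_window_of_floor hC h0 le_rfl (fun t _ => (hcons t).ge) hδ

end Summit.AtomisticToContinuum.FouriersLaw.Theorems.DrudeDissolution.Negative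

end
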